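import Literature.Probability.LatticeModels.IsingLaceConditioning
import Literature.Probability.LatticeModels.IsingLaceTheta
import HarnessLib

/-!
# Sakai's first expansion (2.16)–(2.18): Proposition 1.1 at `j = 0`

Topic `Probability/LatticeModels`, grouping namespace `IsingLace`. Fourth file of the proof
campaign for Sakai 2007, Proposition 1.1 (`IsingLace.Sakai2007_prop11`). After the `tanh` flip
(2.13) (`IsingLaceParity.lean`) and the conditioning on `𝒞^b_n(o) = 𝒜` (2.14)–(2.15)
(`IsingLaceConditioning.lean`), Sakai drops the "off `b`" and "`n_b` even" constraints
((2.16): "`{o ⟺_n b̲} ∖ {o ⟺_n b̲ off b}` and `{∂n = o△b̲} ∩ {n_b odd}` are subsets of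
`{b̄ ∈ 𝒞^b_n(o)}`, on which `⟨φ_b̄ φ_x⟩_{𝒞^b_n(o)ᶜ} = 0`"). Proved here (uniform coupling `β ≥ 0`,
finite graph, sums in `ℝ≥0∞`):

* `even_of_notMem_clusterOff`, `isDoublyConn_update_iff_of_notMem` — the two inclusions of (2.16)
  (handshake on `𝒞^b_n(o)`; a path of `o ⟺_n b̲` cannot use the only bond `b` leaving the cluster
  twice), and the pointwise form `indicator_drop` of the passage (2.15) → (2.16);
* `tsum_isFirstPivotal_eq_tsum_twoPointOff` — **the `b`-summand of (2.11) equals the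
  `b`-summand of (2.16)**:
  `Σ_{∂n = o△x} w(n) 1{b first pivotal} = tanh β · Σ_{∂n = o△b̲} w(n) 1{o ⟺_n b̲} ⟨φ_b̄φ_x⟩_{𝒞^b_n(o)ᶜ}`,
  assembled from the three previous files by un-conditioning (`Σ_𝒜 1{𝒞^b_n(o) = 𝒜}`);
* `theta_univ_eq` — `Θ_{v,x;Λ}[X]` as a single current sum (the linearity and monotonicity of `Θ`
  in the observable are those of `IsingLaceTheta.lean`);
* `first_expansion` — **(2.17)**: `⟨φ_oφ_x⟩_Λ = π^{(0)}_Λ(x) + Σ_b Θ_{o,b̲;Λ}[τ_b ⟨φ_b̄φ_x⟩_{𝒞^b_n(o)ᶜ}]`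
  (back in `ℝ`, dividing by `Z_Λ`);
* `prop11_zero` — **Proposition 1.1 at `j = 0`**: the identity (1.11) with (2.18) and the bounds
  (1.13) (`π^{(0)} ≥ δ`, `0 ≤ R^{(1)} ≤ Σ_b π^{(0)}(b̲)τ_b⟨φ_b̄φ_x⟩_Λ`, the latter from Proposition 2.2
  of `IsingLaceThrough.lean`), i.e. the `j = 0` instance of the named fact `Sakai2007_prop11`.

## References

* A. Sakai, *Lace expansion for the Ising model*, Comm. Math. Phys. 272 (2007) 283–344,
  arXiv:math-ph/0510093, §2.2.1, (2.11)–(2.17) [Sakai2007].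
-/

noncomputable section

open Finset
open scoped symmDiff ENNReal BigOperators

namespace Literature.Probability.LatticeModels

variable {V : Type*} [Fintype V] [DecidableEq V] {G : SimpleGraph V} [DecidableRel G.Adj]

namespace IsingLace

/-! ## The two inclusions of (2.16) -/

/-- A trace bond with exactly one endpoint in `𝒞^b_n(o)` is `b`. [folklore] -/
theorem edge_eq_of_adj_of_mem_clusterOff {n : Current G} {b : G.edgeFinset} {o a c : V}
    (hadj : (Percolation.openGraph n.traced).Adj a c) (ha : a ∈ clusterOff G n b o)
    (hc : c ∉ clusterOff G n b o) : s(a, c) = (b : Sym2 V) := by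
  by_contra hne
  refine hc ?_
  rw [mem_clusterOff_iff] at ha ⊢
  refine SimpleGraph.Reachable.trans ha (SimpleGraph.Adj.reachable ?_)
  rw [SimpleGraph.deleteEdges_adj]
  exact ⟨hadj, fun h => hne (Set.mem_singleton_iff.1 h)⟩

/-- **`{∂n = o△b̲} ∩ {n_b odd} ⊆ {b̄ ∈ 𝒞^b_n(o)}`** (handshake on the cluster `𝒞^b_n(o)` of
`n|_{n_b=0}`, whose sources would be `o △ b̄`). [cite: Sakai2007, (2.16) (the sentence following it)] -/
theorem even_of_notMem_clusterOff {n : Current G} {b : G.edgeFinset} {o u v : V}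
    (hb : (b : Sym2 V) = s(u, v)) (hs : Current.sources n = ({o} : Finset V) ∆ {u})
    (hv : v ∉ clusterOff G n b o) : Even (n b) := by
  classical
  by_contra hodd
  rw [Nat.not_even_iff_odd] at hodd
  set N₀ : Current G := Function.update n b 0 with hN₀
  have hsrc : Current.sources N₀ = ({o} : Finset V) ∆ {v} := by
    have h1 := sources_eq_symmDiff_update n b hb
    rw [if_pos hodd, hs] at h1
    -- `o △ u = ∂N₀ △ (u △ v)` ⇒ `∂N₀ = o △ v`
    have : Current.sources N₀ = (({o} : Finset V) ∆ {u}) ∆ ({u} ∆ {v}) := by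
      rw [h1, symmDiff_assoc, symmDiff_self, symmDiff_bot]
    rw [this, symmDiff_assoc, ← symmDiff_assoc ({u} : Finset V), symmDiff_self, bot_symmDiff]
  set C := clusterOff G n b o with hC_def
  have hC : ∀ w, w ∈ C ↔ (Percolation.openGraph N₀.traced).Reachable o w := fun w => by
    rw [hC_def, clusterOff_eq, Current.mem_cluster_iff]
  have heven := Current.even_card_sources_cluster N₀ o C hC
  have hoC : o ∈ C := (hC o).2 (SimpleGraph.Reachable.refl o)
  have hov : o ≠ v := fun h => hv (h ▸ hoC)
  have hfilter : C.filter (fun w => w ∈ Current.sources N₀) = {o} := by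
    ext w
    simp only [Finset.mem_filter, hsrc, Finset.mem_symmDiff, Finset.mem_singleton]
    constructor
    · rintro ⟨hwC, hw⟩
      rcases hw with ⟨rfl, -⟩ | ⟨rfl, -⟩
      · rfl
      · exact absurd hwC hv
    · rintro rfl
      exact ⟨hoC, Or.inl ⟨rfl, hov⟩⟩
  rw [hfilter, Finset.card_singleton] at heven
  exact Nat.not_even_one heven

/-- **`{o ⟺_n b̲} ∖ {o ⟺_n b̲ off b} ⊆ {b̄ ∈ 𝒞^b_n(o)}`**: if `b̄ ∉ 𝒞^b_n(o)` then `b` is the only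
trace bond leaving the cluster, so no path from `o` to `b̲` uses it, and `o ⟺ b̲` with or without
`b`. [cite: Sakai2007, (2.16) (the sentence following it)] -/
theorem isDoublyConn_update_iff_of_notMem {n : Current G} {b : G.edgeFinset} {o u v : V}
    (hb : (b : Sym2 V) = s(u, v)) (hv : v ∉ clusterOff G n b o) :
    IsDoublyConn G (Function.update n b 0) o u ↔ IsDoublyConn G n o u := by
  classical
  rw [isDoublyConn_iff, isDoublyConn_iff, openGraph_traced_update_zero]
  set T := Percolation.openGraph n.traced with hT
  refine ⟨fun h => h.mono (SimpleGraph.deleteEdges_le _), fun h => ?_⟩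
  rw [SimpleGraph.isEdgeReachable_two] at h ⊢
  intro f
  -- `u ∈ 𝒞^b_n(o)`
  have huC : u ∈ clusterOff G n b o := by
    rw [mem_clusterOff_iff]; exact h b
  obtain ⟨p₀⟩ := h f
  set p : (T.deleteEdges {f}).Walk o u := (p₀.toPath : (T.deleteEdges {f}).Walk o u) with hp
  have hpath : p.IsPath := p₀.toPath.2
  -- the path avoids `b`
  have hbp : (b : Sym2 V) ∉ p.edges := by
    intro hbe
    have hvp : v ∈ p.support := by
      rw [hb] at hbe; exact p.snd_mem_support_of_mem_edges hbe
    set q₁ := p.takeUntil v hvp with hq₁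
    set q₂ := p.dropUntil v hvp with hq₂
    have hspec : q₁.append q₂ = p := p.take_spec hvp
    have hoC : o ∈ clusterOff G n b o := by
      rw [clusterOff_eq]; exact Current.mem_cluster_self _ o
    -- both halves cross the boundary of the cluster, necessarily through `b`
    have hcross : ∀ {a c : V} (q : (T.deleteEdges {f}).Walk a c), a ∈ clusterOff G n b o →
        c ∉ clusterOff G n b o → (b : Sym2 V) ∈ q.edges := by
      intro a c q ha hc
      obtain ⟨d, hd, hd1, hd2⟩ := q.exists_boundary_dart (clusterOff G n b o : Set V) ha hc
      have hadj : T.Adj d.fst d.snd := (SimpleGraph.deleteEdges_adj.1 d.adj).1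
      have he : d.edge = (b : Sym2 V) := edge_eq_of_adj_of_mem_clusterOff hadj hd1 hd2
      rw [← he]
      exact List.mem_map.2 ⟨d, hd, rfl⟩
    have h1 : (b : Sym2 V) ∈ q₁.edges := hcross q₁ hoC hv
    have h2 : (b : Sym2 V) ∈ q₂.edges := by
      have := hcross q₂.reverse huC hv
      rwa [SimpleGraph.Walk.edges_reverse, List.mem_reverse] at this
    have hnodup : p.edges.Nodup := hpath.isTrail.edges_nodup
    rw [← hspec, SimpleGraph.Walk.edges_append] at hnodup
    exact (List.nodup_append.1 hnodup).2.2 _ h1 _ h2 rfl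
  -- transfer the path to `(T ∖ b) ∖ f`
  have hp' : ∀ e ∈ p.edges, e ∉ ({(b : Sym2 V)} : Set (Sym2 V)) := fun e he hmem => by
    rw [Set.mem_singleton_iff] at hmem; exact hbp (hmem ▸ he)
  have w := p.toDeleteEdges {(b : Sym2 V)} hp'
  rw [SimpleGraph.deleteEdges_deleteEdges, Set.union_comm, ← SimpleGraph.deleteEdges_deleteEdges] at w
  exact ⟨w⟩

/-- **The passage (2.15) → (2.16), pointwise**: on `{∂n = o △ b̲}`,
`1{n_b even} 1{o ⟺_{n∖b} b̲} ⟨φ_b̄φ_x⟩_{𝒞^b_n(o)ᶜ} = 1{o ⟺_n b̲} ⟨φ_b̄φ_x⟩_{𝒞^b_n(o)ᶜ}`.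
[cite: Sakai2007, (2.15)–(2.16)] -/
theorem indicator_drop (β : ℝ) {n : Current G} {b : G.edgeFinset} {o u v : V} (x : V)
    (hb : (b : Sym2 V) = s(u, v)) (hs : Current.sources n = ({o} : Finset V) ∆ {u})
    [Decidable (Even (n b) ∧ IsDoublyConn G (Function.update n b 0) o u)] [Decidable (IsDoublyConn G n o u)] :
    (if Even (n b) ∧ IsDoublyConn G (Function.update n b 0) o u then
        ENNReal.ofReal (twoPointOff G β (clusterOff G n b o) v x) else 0) =
      (if IsDoublyConn G n o u then ENNReal.ofReal (twoPointOff G β (clusterOff G n b o) v x) else 0) := by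
  by_cases hv : v ∈ clusterOff G n b o
  · rw [twoPointOff_of_not β (fun h => h.1 hv), ENNReal.ofReal_zero, ite_self, ite_self]
  · have heven := even_of_notMem_clusterOff hb hs hv
    simp only [heven, true_and, isDoublyConn_update_iff_of_notMem hb hv]

/-! ## Un-conditioning and the frozen-cluster identity -/

open Classical in
/-- **Un-conditioning** `Σ_𝒜 1{𝒞^b_n(o) = 𝒜}`: a sum over currents of a function of the cluster is
the sum over the frozen value `𝒜 = S` of the cluster. [cite: Sakai2007, (2.15) (summing over 𝒜 ⊂ Λ)] -/
theorem tsum_eq_sum_tsum_ite_clusterOff (b : G.edgeFinset) (o : V) (F : Current G → Finset V → ℝ≥0∞) :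
    ∑' n : Current G, F n (clusterOff G n b o) =
      ∑ S : Finset V, ∑' n : Current G, if clusterOff G n b o = S then F n S else 0 := by
  rw [← Summable.tsum_finsetSum (fun S _ => ENNReal.summable)]
  refine tsum_congr fun n => ?_
  rw [Finset.sum_eq_single (clusterOff G n b o) (fun S _ hS => if_neg (Ne.symm hS))
    (fun h => absurd (Finset.mem_univ _) h), if_pos rfl]

/-- `ofReal` of a restricted current sum with prescribed sources is the `ℝ≥0∞` sum. [folklore] -/
theorem ofReal_tsum_isSupp_eq (β : ℝ) (hβ : 0 ≤ β) (S B : Finset V) :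
    ENNReal.ofReal (∑' m : Current G, if Current.IsSupp (offGraph G S) m ∧ Current.sources m = B
        then Current.weight β m else 0) =
      ∑' m : Current G, if Current.IsSupp (offGraph G S) m ∧ Current.sources m = B
        then ENNReal.ofReal (Current.weight β m) else 0 := by
  rw [ENNReal.ofReal_tsum_of_nonneg (fun m => ?_) (summable_weight_isSupp_offGraph β S B)]
  · refine tsum_congr fun m => ?_
    split_ifs
    · rfl
    · exact ENNReal.ofReal_zero
  · split_ifs
    · exact Current.weight_nonneg hβ m
    · exact le_rfl

/-- `Z_{Sᶜ}` in `ℝ≥0∞`. [folklore] -/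
theorem ofReal_zOff_eq {β : ℝ} (hβ : 0 ≤ β) (S : Finset V) :
    ENNReal.ofReal (zOff G β S) =
      ∑' m : Current G, if Current.IsSupp (offGraph G S) m ∧ Current.sources m = ∅
        then ENNReal.ofReal (Current.weight β m) else 0 :=
  ofReal_tsum_isSupp_eq β hβ S ∅

open Classical in
/-- **The frozen-cluster identity** ((2.13) → (2.16) at `𝒞^b_n(o) = S`, divided by `Z_{Sᶜ}`):
`Σ_n 1{∂n = o△x△b̲△b̄, n_b even, o ⟺_{n∖b} b̲, 𝒞^b_n(o) = S, b̄ ⟷_n x in Sᶜ} w(n)`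
`= (Σ_n 1{∂n = o△b̲, n_b even, o ⟺_{n∖b} b̲, 𝒞^b_n(o) = S} w(n)) · ⟨φ_b̄φ_x⟩_{Sᶜ}`
(both sides vanish unless `b̄, x ∉ S`). [cite: Sakai2007, (2.14)–(2.15)] -/
theorem frozen_cluster_eq {β : ℝ} (hβ : 0 ≤ β) {o u v : V} (x : V) (b : G.edgeFinset)
    (hb : (b : Sym2 V) = s(u, v)) (S : Finset V) :
    ∑' n : Current G, (if Current.sources n = (({o} : Finset V) ∆ {x}) ∆ ({u} ∆ {v}) ∧ Even (n b) ∧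
        IsDoublyConn G (Function.update n b 0) o u ∧ clusterOff G n b o = S ∧ ConnAvoid G n S v x
        then ENNReal.ofReal (Current.weight β n) else 0) =
      (∑' n : Current G, if Current.sources n = ({o} : Finset V) ∆ {u} ∧ Even (n b) ∧
          IsDoublyConn G (Function.update n b 0) o u ∧ clusterOff G n b o = S
          then ENNReal.ofReal (Current.weight β n) else 0) *
        ENNReal.ofReal (twoPointOff G β S v x) := by
  by_cases hvx : v ∉ S ∧ x ∉ S
  · have hci := conditioning_identity hβ b hb hvx.1 hvx.2 (o := o)
    set Z := ∑' m : Current G, (if Current.IsSupp (offGraph G S) m ∧ Current.sources m = ∅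
      then ENNReal.ofReal (Current.weight β m) else 0) with hZ
    set M := ∑' m : Current G, (if Current.IsSupp (offGraph G S) m ∧
      Current.sources m = ({v} : Finset V) ∆ {x} then ENNReal.ofReal (Current.weight β m) else 0) with hM
    have hZeq : ENNReal.ofReal (zOff G β S) = Z := ofReal_zOff_eq hβ S
    have hZ0 : Z ≠ 0 := by
      rw [← hZeq]; exact (ENNReal.ofReal_pos.2 (zOff_pos β S)).ne'
    have hZtop : Z ≠ ⊤ := by rw [← hZeq]; exact ENNReal.ofReal_ne_top
    have htpo : ENNReal.ofReal (twoPointOff G β S v x) = M / Z := by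
      rw [twoPointOff_eq_tsum_div β S hvx.1 hvx.2, ENNReal.ofReal_div_of_pos (zOff_pos β S), hZeq,
        ofReal_tsum_isSupp_eq β hβ]
    rw [htpo, ← mul_div_assoc, ENNReal.eq_div_iff hZ0 hZtop, mul_comm Z, hci]
  · -- both sides vanish
    rw [twoPointOff_of_not β hvx, ENNReal.ofReal_zero, mul_zero]
    refine ENNReal.tsum_eq_zero.2 fun n => if_neg ?_
    rintro ⟨-, -, -, -, hav⟩
    exact hvx ⟨(connAvoid_iff.1 hav).1, (connAvoid_iff.1 hav).2.1⟩

/-! ## The `b`-summand of (2.17) -/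

open Classical in
/-- **The `b`-summand of the first expansion**: for `β ≥ 0` and a directed bond `b = (b̲, b̄)`,
`Σ_{∂n = o△x} w(n) 1{b first pivotal for o → x}`
`= tanh β · Σ_{∂n = o△b̲} w(n) 1{o ⟺_n b̲} ⟨φ_b̄ φ_x⟩_{𝒞^b_n(o)ᶜ}` ((2.11) → (2.16)).
[cite: Sakai2007, (2.11)–(2.16)] -/
theorem tsum_isFirstPivotal_eq_tsum_twoPointOff {β : ℝ} (hβ : 0 ≤ β) (o x : V) (d : G.Dart) :
    ∑' n : Current G, (if Current.sources n = ({o} : Finset V) ∆ {x} ∧ IsFirstPivotal G n o x d then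
        ENNReal.ofReal (Current.weight β n) else 0) =
      ENNReal.ofReal (Real.tanh β) * ∑' n : Current G,
        (if Current.sources n = ({o} : Finset V) ∆ {d.fst} ∧ IsDoublyConn G n o d.fst then
          ENNReal.ofReal (Current.weight β n) *
            ENNReal.ofReal (twoPointOff G β (clusterOff G n (dartEdge G d) o) d.snd x) else 0) := by
  set b := dartEdge G d with hb_def
  have hb : ((b : G.edgeFinset) : Sym2 V) = s(d.fst, d.snd) := rfl
  rw [tsum_isFirstPivotal_eq hβ o x d]
  congr 1
  -- un-condition on the cluster
  have step1 := tsum_eq_sum_tsum_ite_clusterOff b o fun n S =>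
    if Current.sources n = (({o} : Finset V) ∆ {x}) ∆ ({d.fst} ∆ {d.snd}) ∧ Even (n b) ∧
        (IsDoublyConn G (Function.update n b 0) o d.fst ∧ ConnAvoid G n S d.snd x)
      then ENNReal.ofReal (Current.weight β n) else 0
  rw [step1]
  -- freeze the cluster and apply the conditioning identity
  have step2 : ∀ S : Finset V,
      (∑' n : Current G, if clusterOff G n b o = S then
        (if Current.sources n = (({o} : Finset V) ∆ {x}) ∆ ({d.fst} ∆ {d.snd}) ∧ Even (n b) ∧
            (IsDoublyConn G (Function.update n b 0) o d.fst ∧ ConnAvoid G n S d.snd x)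
          then ENNReal.ofReal (Current.weight β n) else 0) else 0) =
      (∑' n : Current G, if Current.sources n = ({o} : Finset V) ∆ {d.fst} ∧ Even (n b) ∧
          IsDoublyConn G (Function.update n b 0) o d.fst ∧ clusterOff G n b o = S
          then ENNReal.ofReal (Current.weight β n) else 0) *
        ENNReal.ofReal (twoPointOff G β S d.snd x) := by
    intro S
    rw [← frozen_cluster_eq hβ x b hb S]
    refine tsum_congr fun n => ?_
    by_cases hS : clusterOff G n b o = S
    · rw [if_pos hS]
      by_cases hc : Current.sources n = (({o} : Finset V) ∆ {x}) ∆ ({d.fst} ∆ {d.snd}) ∧ Even (n b) ∧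
          (IsDoublyConn G (Function.update n b 0) o d.fst ∧ ConnAvoid G n S d.snd x)
      · rw [if_pos hc, if_pos ⟨hc.1, hc.2.1, hc.2.2.1, hS, hc.2.2.2⟩]
      · rw [if_neg hc, if_neg (fun h => hc ⟨h.1, h.2.1, h.2.2.1, h.2.2.2.2⟩)]
    · rw [if_neg hS, if_neg (fun h => hS h.2.2.2.1)]
  rw [Finset.sum_congr rfl fun S _ => step2 S]
  -- re-sum over the cluster
  have step3 := tsum_eq_sum_tsum_ite_clusterOff b o fun n S =>
    if Current.sources n = ({o} : Finset V) ∆ {d.fst} ∧ Even (n b) ∧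
        IsDoublyConn G (Function.update n b 0) o d.fst
      then ENNReal.ofReal (Current.weight β n) * ENNReal.ofReal (twoPointOff G β S d.snd x) else 0
  have step3' : ∀ S : Finset V,
      (∑' n : Current G, if Current.sources n = ({o} : Finset V) ∆ {d.fst} ∧ Even (n b) ∧
          IsDoublyConn G (Function.update n b 0) o d.fst ∧ clusterOff G n b o = S
          then ENNReal.ofReal (Current.weight β n) else 0) *
        ENNReal.ofReal (twoPointOff G β S d.snd x) =
      ∑' n : Current G, if clusterOff G n b o = S then
        (if Current.sources n = ({o} : Finset V) ∆ {d.fst} ∧ Even (n b) ∧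
            IsDoublyConn G (Function.update n b 0) o d.fst
          then ENNReal.ofReal (Current.weight β n) * ENNReal.ofReal (twoPointOff G β S d.snd x) else 0)
        else 0 := by
    intro S
    rw [← ENNReal.tsum_mul_right]
    refine tsum_congr fun n => ?_
    by_cases hS : clusterOff G n b o = S
    · rw [if_pos hS]
      by_cases hc : Current.sources n = ({o} : Finset V) ∆ {d.fst} ∧ Even (n b) ∧
          IsDoublyConn G (Function.update n b 0) o d.fst
      · rw [if_pos hc, if_pos ⟨hc.1, hc.2.1, hc.2.2, hS⟩]
      · rw [if_neg hc, if_neg (fun h => hc ⟨h.1, h.2.1, h.2.2.1⟩), zero_mul]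
    · rw [if_neg hS, if_neg (fun h => hS h.2.2.2), zero_mul]
  rw [Finset.sum_congr rfl fun S _ => step3' S, ← step3]
  -- drop `n_b even` and `off b` ((2.16))
  refine tsum_congr fun n => ?_
  by_cases hs : Current.sources n = ({o} : Finset V) ∆ {d.fst}
  · have h := indicator_drop β x hb hs (v := d.snd)
    by_cases hc : Even (n b) ∧ IsDoublyConn G (Function.update n b 0) o d.fst
    · rw [if_pos hc] at h
      rw [if_pos ⟨hs, hc⟩]
      by_cases hd : IsDoublyConn G n o d.fst
      · rw [if_pos ⟨hs, hd⟩]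
      · rw [if_neg hd] at h
        rw [if_neg (fun h' => hd h'.2), h, mul_zero]
    · rw [if_neg hc] at h
      rw [if_neg (fun h' => hc h'.2)]
      by_cases hd : IsDoublyConn G n o d.fst
      · rw [if_pos hd] at h
        rw [if_pos ⟨hs, hd⟩, ← h, mul_zero]
      · rw [if_neg (fun h' => hd h'.2)]
  · rw [if_neg (fun h => hs h.1), if_neg (fun h => hs h.1)]

/-! ## Back to real numbers: `Θ` on `𝔹_Λ`, linearity, and the first expansion (2.17) -/

open Classical in
/-- **`Θ_{v,x;Λ}[X] = Σ_{∂n = v△x} (w_Λ(n)/Z_Λ) 1{v ⟺_n x} X(n)`**: in `Θ_{v,x;Λ}` the current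
`m` on `𝔹_∅` vanishes and `Z_∅ = 1` ((2.30) with `𝒜 = Λ`, Remark (c) of Definition 2.1; cf.
(2.36)). [cite: Sakai2007, (2.30) and (2.36)] -/
theorem theta_univ_eq (β : ℝ) (v x : V) (X : Current G → ℝ) :
    theta G β univ v x X = ∑' n : Current G,
      if Current.sources n = ({v} : Finset V) ∆ {x} ∧ IsDoublyConn G n v x then
        Current.weight β n / currentSum G β ∅ * X n else 0 := by
  unfold theta
  rw [zOff_univ, zOff_empty]
  have hsupp : ∀ p : Current G × Current G,
      (if Current.IsSupp (offGraph G univ) p.1 ∧ p.1.sources = ∅ then p.1.weight β / 1 else 0) *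
        (if p.2.sources = ({v} : Finset V) ∆ {x} then p.2.weight β / currentSum G β ∅ else 0) *
        (if laceEvent G (p.1 + p.2) univ v x then X (p.1 + p.2) else 0) ≠ 0 →
        p ∈ Set.range fun n : Current G => ((0 : Current G), n) := by
    intro p hp
    refine ⟨p.2, ?_⟩
    have h1 : Current.IsSupp (offGraph G univ) p.1 := by
      by_contra h
      apply hp
      rw [if_neg (fun h' => h h'.1), zero_mul, zero_mul]
    rw [Prod.ext_iff]
    exact ⟨(eq_zero_of_isSupp_offGraph_univ h1).symm, rfl⟩
  rw [← Function.Injective.tsum_eq (f := fun p : Current G × Current G =>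
      (if Current.IsSupp (offGraph G univ) p.1 ∧ p.1.sources = ∅ then p.1.weight β / 1 else 0) *
        (if p.2.sources = ({v} : Finset V) ∆ {x} then p.2.weight β / currentSum G β ∅ else 0) *
        (if laceEvent G (p.1 + p.2) univ v x then X (p.1 + p.2) else 0))
      (g := fun n : Current G => ((0 : Current G), n)) (fun a b h => (Prod.ext_iff.1 h).2)
      (fun p hp => hsupp p hp)]
  refine tsum_congr fun n => ?_
  simp only [Current.isSupp_zero, Current.sources_zero, true_and, if_true, Current.weight_zero,
    div_one, one_mul, zero_add, laceEvent_univ_iff]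
  by_cases hs : n.sources = ({v} : Finset V) ∆ {x}
  · by_cases hd : IsDoublyConn G n v x
    · rw [if_pos hs, if_pos hd, if_pos ⟨hs, hd⟩]
    · rw [if_pos hs, if_neg hd, if_neg (fun h => hd h.2), mul_zero]
  · rw [if_neg hs, zero_mul, if_neg (fun h => hs h.1)]

/-- `|⟨φ_vφ_x⟩_{𝒜ᶜ}| ≤ 1`. [folklore] -/
theorem abs_twoPointOff_le_one (β : ℝ) (A : Finset V) (v x : V) : |twoPointOff G β A v x| ≤ 1 := by
  unfold twoPointOff
  split_ifs
  · exact abs_isingTwoPoint_le_one _ _ _ _ _ _ _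
  · rw [abs_zero]; exact zero_le_one

/-! ### Real ↔ `ℝ≥0∞` conversions -/

/-- `ofReal` through an indicator. [folklore] -/
theorem ofReal_ite (P : Prop) [Decidable P] (a : ℝ) :
    ENNReal.ofReal (if P then a else 0) = if P then ENNReal.ofReal a else 0 := by
  split_ifs
  · rfl
  · exact ENNReal.ofReal_zero

/-- The current sum with prescribed sources in `ℝ≥0∞`. [folklore] -/
theorem ofReal_currentSum {β : ℝ} (hβ : 0 ≤ β) (B : Finset V) :
    ENNReal.ofReal (currentSum G β B) =
      ∑' n : Current G, if Current.sources n = B then ENNReal.ofReal (Current.weight β n) else 0 := by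
  unfold currentSum
  rw [ENNReal.ofReal_tsum_of_nonneg (fun n => ?_) (summable_currentWeight_indicator_holds G β B)]
  · exact tsum_congr fun n => ofReal_ite _ _
  · split_ifs
    · exact Current.weight_nonneg hβ n
    · exact le_rfl

omit [DecidableEq V] in
/-- A weight sum restricted by a predicate and multiplied by a factor in `[0, 1]` is summable and
its `ofReal` is the `ℝ≥0∞` sum. [folklore] -/
theorem summable_and_ofReal_tsum_weight_mul {β : ℝ} (hβ : 0 ≤ β) (P : Current G → Prop)
    [DecidablePred P] (F : Current G → ℝ) (hF0 : ∀ n, 0 ≤ F n) (hF1 : ∀ n, F n ≤ 1) :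
    Summable (fun n : Current G => if P n then Current.weight β n * F n else 0) ∧
      ENNReal.ofReal (∑' n : Current G, if P n then Current.weight β n * F n else 0) =
        ∑' n : Current G, if P n then ENNReal.ofReal (Current.weight β n) * ENNReal.ofReal (F n) else 0 := by
  have hs : Summable (fun n : Current G => if P n then Current.weight β n * F n else 0) := by
    refine (Current.summable_weight_abs G β).of_norm_bounded fun n => ?_
    rw [Real.norm_eq_abs]
    split_ifs
    · rw [abs_mul, Current.abs_weight, abs_of_nonneg (hF0 n)]
      exact mul_le_of_le_one_right (Current.weight_nonneg (abs_nonneg β) n) (hF1 n)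
    · rw [abs_zero]; exact Current.weight_nonneg (abs_nonneg β) n
  refine ⟨hs, ?_⟩
  rw [ENNReal.ofReal_tsum_of_nonneg (fun n => ?_) hs]
  · refine tsum_congr fun n => ?_
    rw [ofReal_ite]
    split_ifs
    · rw [ENNReal.ofReal_mul (Current.weight_nonneg hβ n)]
    · rfl
  · split_ifs
    · exact mul_nonneg (Current.weight_nonneg hβ n) (hF0 n)
    · exact le_rfl

open Classical in
/-- (2.9) in `ℝ≥0∞`, weighted: on `{∂n = o △ x}` (where `o ⟷_n x` automatically),
`w(n) = w(n) 1{o ⟺_n x} + Σ_b w(n) 1{b first pivotal}`. [cite: Sakai2007, (2.9) and (2.11)] -/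
theorem weight_indicator_split (β : ℝ) (o x : V) (n : Current G) :
    (if Current.sources n = ({o} : Finset V) ∆ {x} then ENNReal.ofReal (Current.weight β n) else 0) =
      (if Current.sources n = ({o} : Finset V) ∆ {x} ∧ IsDoublyConn G n o x then
          ENNReal.ofReal (Current.weight β n) else 0) +
        ∑ d : G.Dart, (if Current.sources n = ({o} : Finset V) ∆ {x} ∧ IsFirstPivotal G n o x d then
          ENNReal.ofReal (Current.weight β n) else 0) := by
  by_cases hs : Current.sources n = ({o} : Finset V) ∆ {x}
  · have hconn : Conn G n o x := by
      have h := conn_add_of_sources_eq (0 : Current G) hs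
      rwa [zero_add] at h
    have hreal := indicator_conn_eq (G := G) (N := n) (o := o) (x := x)
    rw [if_pos hconn] at hreal
    -- transport the `0/1` identity through `ofReal` and multiply by the weight
    have hE : (1 : ℝ≥0∞) = (if IsDoublyConn G n o x then (1 : ℝ≥0∞) else 0) +
        ∑ d : G.Dart, (if IsFirstPivotal G n o x d then (1 : ℝ≥0∞) else 0) := by
      have h := congrArg ENNReal.ofReal hreal
      rw [ENNReal.ofReal_one, ENNReal.ofReal_add (by positivity) (Finset.sum_nonneg fun d _ => by positivity),
        ENNReal.ofReal_sum_of_nonneg (fun d _ => by positivity)] at h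
      simpa only [apply_ite ENNReal.ofReal, ENNReal.ofReal_one, ENNReal.ofReal_zero] using h
    simp only [hs, true_and]
    calc ENNReal.ofReal (Current.weight β n) = ENNReal.ofReal (Current.weight β n) * 1 := (mul_one _).symm
      _ = ENNReal.ofReal (Current.weight β n) * ((if IsDoublyConn G n o x then (1 : ℝ≥0∞) else 0) +
            ∑ d : G.Dart, (if IsFirstPivotal G n o x d then (1 : ℝ≥0∞) else 0)) := by rw [← hE]
      _ = _ := by
          rw [mul_add, Finset.mul_sum, mul_ite, mul_one, mul_zero]
          congr 1
          exact Finset.sum_congr rfl fun d _ => by rw [mul_ite, mul_one, mul_zero]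
  · rw [if_neg hs, if_neg (fun h => hs h.1)]
    rw [Finset.sum_eq_zero (fun d _ => if_neg (fun h => hs h.1)), add_zero]

open Classical in
/-- **The first expansion in `ℝ≥0∞`**:
`Σ_{∂n = o△x} w(n) = Σ_{∂n = o△x} w(n) 1{o ⟺_n x} + Σ_b tanh β Σ_{∂n = o△b̲} w(n) 1{o ⟺_n b̲} ⟨φ_b̄φ_x⟩_{𝒞^b_n(o)ᶜ}`
((2.9)–(2.16), multiplied by `Z_Λ`). [cite: Sakai2007, (2.9)–(2.17)] -/
theorem tsum_weight_sources_eq {β : ℝ} (hβ : 0 ≤ β) (o x : V) :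
    ∑' n : Current G, (if Current.sources n = ({o} : Finset V) ∆ {x} then
        ENNReal.ofReal (Current.weight β n) else 0) =
      (∑' n : Current G, if Current.sources n = ({o} : Finset V) ∆ {x} ∧ IsDoublyConn G n o x then
          ENNReal.ofReal (Current.weight β n) else 0) +
        ∑ d : G.Dart, ENNReal.ofReal (Real.tanh β) * ∑' n : Current G,
          (if Current.sources n = ({o} : Finset V) ∆ {d.fst} ∧ IsDoublyConn G n o d.fst then
            ENNReal.ofReal (Current.weight β n) *
              ENNReal.ofReal (twoPointOff G β (clusterOff G n (dartEdge G d) o) d.snd x) else 0) := by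
  rw [tsum_congr (weight_indicator_split β o x), ENNReal.tsum_add,
    Summable.tsum_finsetSum (fun d _ => ENNReal.summable)]
  congr 1
  exact Finset.sum_congr rfl fun d _ => tsum_isFirstPivotal_eq_tsum_twoPointOff hβ o x d

open Classical in
/-- **Sakai 2007, (2.17) — the first expansion**, for the uniform ferromagnetic coupling on a
finite graph: `⟨φ_oφ_x⟩_Λ = π^{(0)}_Λ(x) + Σ_b Θ_{o,b̲;Λ}[ τ_b ⟨φ_b̄ φ_x⟩_{𝒞^b_n(o)ᶜ} ]`
(with `Σ_b` over directed bonds and `τ_b = tanh β`). [cite: Sakai2007, (2.17)] -/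
theorem first_expansion {β : ℝ} (hβ : 0 ≤ β) (o x : V) :
    isingTwoPoint G univ β 0 .free o x =
      coeff G β o 0 x + ∑ d : G.Dart, theta G β univ o d.fst
        (fun N => Real.tanh β * twoPointOff G β (clusterOff G N (dartEdge G d) o) d.snd x) := by
  have htanh : 0 ≤ Real.tanh β := tanh_nonneg_of_nonneg hβ
  set Z := currentSum G β ∅ with hZ
  have hZpos : 0 < Z := currentSum_empty_pos' G β
  -- the real quantities
  set A : ℝ := ∑' n : Current G, if Current.sources n = ({o} : Finset V) ∆ {x} ∧ IsDoublyConn G n o x then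
    Current.weight β n else 0 with hA
  set Sd : G.Dart → ℝ := fun d => ∑' n : Current G,
    if Current.sources n = ({o} : Finset V) ∆ {d.fst} ∧ IsDoublyConn G n o d.fst then
      Current.weight β n * twoPointOff G β (clusterOff G n (dartEdge G d) o) d.snd x else 0 with hSd
  -- their `ofReal`s
  have hA' := summable_and_ofReal_tsum_weight_mul hβ
    (fun n : Current G => Current.sources n = ({o} : Finset V) ∆ {x} ∧ IsDoublyConn G n o x)
    (fun _ => (1 : ℝ)) (fun _ => zero_le_one) (fun _ => le_rfl)
  simp only [mul_one, ENNReal.ofReal_one] at hA'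
  have hSd' : ∀ d : G.Dart, _ := fun d => summable_and_ofReal_tsum_weight_mul hβ
    (fun n : Current G => Current.sources n = ({o} : Finset V) ∆ {d.fst} ∧ IsDoublyConn G n o d.fst)
    (fun n => twoPointOff G β (clusterOff G n (dartEdge G d) o) d.snd x)
    (fun n => twoPointOff_nonneg hβ _ _ _)
    (fun n => (le_abs_self _).trans (abs_twoPointOff_le_one β _ _ _))
  have hA0 : 0 ≤ A := tsum_nonneg fun n => by
    split_ifs
    · exact Current.weight_nonneg hβ n
    · exact le_rfl
  have hSd0 : ∀ d, 0 ≤ Sd d := fun d => tsum_nonneg fun n => by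
    split_ifs
    · exact mul_nonneg (Current.weight_nonneg hβ n) (twoPointOff_nonneg hβ _ _ _)
    · exact le_rfl
  -- the master identity in `ℝ`
  have hmaster : currentSum G β (({o} : Finset V) ∆ {x}) = A + ∑ d : G.Dart, Real.tanh β * Sd d := by
    have h := tsum_weight_sources_eq (G := G) hβ o x
    rw [← ofReal_currentSum hβ, ← hA'.2] at h
    rw [Finset.sum_congr rfl fun d _ => by rw [← (hSd' d).2, ← ENNReal.ofReal_mul htanh]] at h
    rw [← ENNReal.ofReal_sum_of_nonneg (fun d _ => mul_nonneg htanh (hSd0 d)),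
      ← ENNReal.ofReal_add hA0 (Finset.sum_nonneg fun d _ => mul_nonneg htanh (hSd0 d))] at h
    exact (ENNReal.ofReal_eq_ofReal_iff (currentSum_nonneg G hβ _)
      (add_nonneg hA0 (Finset.sum_nonneg fun d _ => mul_nonneg htanh (hSd0 d)))).1 h
  -- divide by `Z`
  rw [twoPoint_eq_div, zOff_empty, hmaster, add_div, Finset.sum_div]
  congr 1
  · rw [coeff_zero_eq, hA, ← tsum_div_const]
    refine tsum_congr fun n => ?_
    split_ifs
    · rfl
    · rw [zero_div]
  · refine Finset.sum_congr rfl fun d _ => ?_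
    rw [theta_univ_eq, hSd]
    simp only
    rw [mul_comm (Real.tanh β), ← div_mul_eq_mul_div, ← tsum_div_const, ← tsum_mul_right]
    refine tsum_congr fun n => ?_
    split_ifs
    · ring
    · rw [zero_div, zero_mul]

/-! ## Proposition 1.1 at `j = 0` -/

/-- `Π^{(0)} = π^{(0)}`. [cite: Sakai2007, (1.12)] -/
theorem coeffSum_zero (β : ℝ) (o y : V) : coeffSum G β o 0 y = coeff G β o 0 y := by
  unfold coeffSum
  rw [zero_add, Finset.sum_range_one, pow_zero, one_mul]

open Classical in
/-- `π^{(0)}_Λ(o) = 1`: every sourceless current doubly connects `o` to itself. [cite: Sakai2007, (1.13) and (2.10)] -/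
theorem coeff_zero_self (β : ℝ) (o : V) : coeff G β o 0 o = 1 := by
  rw [coeff_zero_eq]
  have hZ : 0 < currentSum G β ∅ := currentSum_empty_pos' G β
  have h : ∀ n : Current G, (if Current.sources n = ({o} : Finset V) ∆ {o} ∧ IsDoublyConn G n o o then
      Current.weight β n / currentSum G β ∅ else 0) =
      (if Current.sources n = ∅ then Current.weight β n else 0) / currentSum G β ∅ := fun n => by
    rw [symmDiff_self, Finset.bot_eq_empty]
    have hdc : IsDoublyConn G n o o := isDoublyConn_iff.2 (SimpleGraph.IsEdgeReachable.refl o)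
    by_cases hs : Current.sources n = ∅
    · rw [if_pos ⟨hs, hdc⟩, if_pos hs]
    · rw [if_neg (fun h => hs h.1), if_neg hs, zero_div]
  rw [tsum_congr h, tsum_div_const]
  exact div_self hZ.ne'

/-- **Sakai 2007, Proposition 1.1 at `j = 0`** for the uniform ferromagnetic coupling on a finite
graph: the identity (1.11) with `Π^{(0)} = π^{(0)}` and `R^{(1)}` ((2.17)–(2.18)), and the bounds
(1.13): `π^{(0)}(x) ≥ δ_{o,x}`, `0 ≤ R^{(1)}(x) ≤ Σ_b π^{(0)}(b̲) τ_b ⟨φ_b̄φ_x⟩_Λ` (from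
`⟨φ_b̄φ_x⟩_{𝒞ᶜ} ≤ ⟨φ_b̄φ_x⟩_Λ`, Proposition 2.2). This is the `j = 0` instance of the tree's named
fact `IsingLace.Sakai2007_prop11`. [cite: Sakai2007, Proposition 1.1 (j = 0), (2.17)–(2.18)] -/
theorem prop11_zero {β : ℝ} (hβ : 0 ≤ β) (o x : V) :
    (isingTwoPoint G univ β 0 .free o x = coeffSum G β o 0 x +
        (∑ d : G.Dart, coeffSum G β o 0 d.fst * Real.tanh β * isingTwoPoint G univ β 0 .free d.snd x) +
        (-1 : ℝ) ^ (0 + 1) * remainder G β o (0 + 1) x) ∧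
      (if (0 : ℕ) = 0 ∧ x = o then (1 : ℝ) else 0) ≤ coeff G β o 0 x ∧
      0 ≤ remainder G β o (0 + 1) x ∧
      remainder G β o (0 + 1) x ≤
        ∑ d : G.Dart, coeff G β o 0 d.fst * Real.tanh β * isingTwoPoint G univ β 0 .free d.snd x := by
  classical
  have htanh : 0 ≤ Real.tanh β := tanh_nonneg_of_nonneg hβ
  -- the two observables of the `b`-term
  set T : G.Dart → ℝ := fun d => isingTwoPoint G univ β 0 .free d.snd x with hT
  set X : G.Dart → Current G → ℝ := fun d _ => Real.tanh β * T d with hX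
  set Y : G.Dart → Current G → ℝ := fun d N =>
    Real.tanh β * (T d - twoPointOff G β (clusterOff G N (dartEdge G d) o) d.snd x) with hY
  have hT1 : ∀ d, |T d| ≤ 1 := fun d => abs_isingTwoPoint_le_one _ _ _ _ _ _ _
  have hXb : ∀ d N, |X d N| ≤ |Real.tanh β| := fun d N => by
    simp only [hX, abs_mul]
    exact mul_le_of_le_one_right (abs_nonneg _) (hT1 d)
  have hYb : ∀ d N, |Y d N| ≤ |Real.tanh β| * 2 := fun d N => by
    simp only [hY, abs_mul]
    refine mul_le_mul_of_nonneg_left ((abs_sub _ _).trans ?_) (abs_nonneg _)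
    have := abs_twoPointOff_le_one (G := G) β (clusterOff G N (dartEdge G d) o) d.snd x
    linarith [hT1 d]
  have hYX : ∀ d N, Y d N ≤ X d N := fun d N => by
    simp only [hX, hY]
    exact mul_le_mul_of_nonneg_left (sub_le_self _ (twoPointOff_nonneg hβ _ _ _)) htanh
  have hY0 : ∀ d N, 0 ≤ Y d N := fun d N => by
    simp only [hY]
    exact mul_nonneg htanh (sub_nonneg.2 (twoPointOff_le_twoPoint hβ _ _ _))
  -- `Θ[X_b] = π^{(0)}(b̲) τ_b ⟨φ_b̄φ_x⟩`, `R^{(1)} = Σ_b Θ[Y_b]`, `Θ[X_b] - Θ[Y_b] = Θ[τ_b ⟨⟩_{𝒞ᶜ}]`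
  have hthetaX : ∀ d, theta G β univ o d.fst (X d) = coeff G β o 0 d.fst * Real.tanh β * T d := fun d => by
    have h := theta_const_mul (G := G) (β := β) (A := univ) (v := o) (x := d.fst) (Real.tanh β * T d)
      (fun _ => (1 : ℝ))
    simp only [mul_one] at h
    rw [hX, h, coeff, piKernel]
    ring
  have hR : remainder G β o (0 + 1) x = ∑ d : G.Dart, theta G β univ o d.fst (Y d) := rfl
  have hsub : ∀ d, theta G β univ o d.fst (X d) - theta G β univ o d.fst (Y d) =
      theta G β univ o d.fst
        (fun N => Real.tanh β * twoPointOff G β (clusterOff G N (dartEdge G d) o) d.snd x) := fun d => by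
    rw [← theta_sub (β := β) (A := univ) (v := o) (x := d.fst) ⟨_, hXb d⟩ ⟨_, hYb d⟩]
    congr 1
    funext N
    simp only [hX, hY]
    ring
  refine ⟨?_, ?_, ?_, ?_⟩
  · -- the identity (2.17)–(2.18)
    rw [first_expansion hβ o x, coeffSum_zero, hR, zero_add, pow_one, neg_one_mul, ← sub_eq_add_neg,
      add_sub_assoc, ← Finset.sum_sub_distrib]
    congr 1
    refine Finset.sum_congr rfl fun d _ => ?_
    rw [coeffSum_zero, ← hthetaX d, hsub d]
  · -- `π^{(0)}(x) ≥ δ_{o,x}`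
    split_ifs with h
    · rw [h.2, coeff_zero_self]
    · exact coeff_nonneg hβ o 0 x
  · -- `R^{(1)} ≥ 0`
    rw [hR]
    exact Finset.sum_nonneg fun d _ => theta_nonneg hβ univ o d.fst (hY0 d)
  · -- `R^{(1)} ≤ Σ_b π^{(0)}(b̲) τ_b ⟨φ_b̄ φ_x⟩`
    rw [hR]
    refine Finset.sum_le_sum fun d _ => ?_
    rw [← hthetaX d]
    exact theta_mono hβ ⟨_, hYb d⟩ ⟨_, hXb d⟩ (hYX d)

end IsingLace

end Literature.Probability.LatticeModels

end
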